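import Literature.AlgebraicTopology.CharacteristicClasses.CompletionThomClassLocalModel
import Literature.AlgebraicTopology.CharacteristicClasses.LineLocalIndexUnit
import HarnessLib

/-!
# The model Thom class of rank `k` pairs to `±1` with every local orientation generator of the fibre

J. Milnor, J. Stasheff, *Characteristic Classes* (1974), §9 Thm. 9.1: the Thom class of an oriented
`n`-plane bundle restricts on each fibre pair `(F, F₀)` to the preferred generator `u_F` of
`Hⁿ(F, F₀; ℤ) ≅ ℤ`, the class taking the value `+1` on the orientation generator of `Hₙ(F, F₀; ℤ)`;
D. Husemoller, *Fibre Bundles* (1994), Ch. 17 §2 (2.3) (`H*(ℂPᵏ; ℤ)` is free on `1, x, …, xᵏ`);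
A. Hatcher, *Algebraic Topology* (2002), §3.1 Thm. 3.2 (universal coefficients for pairs: over a
PID the Kronecker map `Hᵐ(X, A) → Hom(Hₘ(X, A), ℤ)` is onto), Thm. 3.12 / 3.19, §3.3 p. 231
(excision for local homology).

For the model classes of `CompletionThomClassLocalModel` in rank `k = dim F ≥ 1` —
`ω_k = xᵏ ∈ H²ᵏ(ℙ(F ⊕ ℂ); ℤ)`, its unique relative lift `ω_k^rel ∈ H²ᵏ(ℙ, ℙ ∖ [0 : 1]; ℤ)` and
`ω_k^rel,vec = α^* ω_k^rel ∈ H²ᵏ(F, F ∖ 0; ℤ)` — this file proves that the tree's normalisation of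
the Thom class (through the Chern classes of the completed bundle) agrees UP TO SIGN with
Milnor–Stasheff's, in every rank:

* `relKroneckerM_surjective` — the Kronecker map of a pair against Mathlib's relative homology is
  onto over a PID (transfer of the tree's `relKronecker_surjective`);
* `exists_eq_smul_xpow_top` — **`H²ᵏ(ℙ(V); R) = R · xᵏ`** for `dim V = k + 1` (the Leray–Hirsch
  theorem of `ProjectiveSpaceLerayHirsch` over a point), hence `exists_eq_smul_omegaRelK`:
  **every class of `H²ᵏ(ℙ(F ⊕ ℂ), ℙ ∖ [0 : 1]; ℤ)` is a multiple of `ω_k^rel`**;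
* **`relKroneckerM_omegaRelVecK_eq_one_or_eq_neg_one`** — for every generator `γ` of
  `H₂ₖ(F, F ∖ 0; ℤ) ≅ ℤ`: **`⟨ω_k^rel,vec, γ⟩ = ±1`**.  Proof: `⟨α^* ω^rel, γ⟩ = ⟨ω^rel, α_* γ⟩`; a
  functional `φ` on `H₂ₖ(ℙ, ℙ₀; ℤ)` with `φ(α_* γ) = 1` exists (`α_* γ` is a generator) and is
  `⟨c, ·⟩` for some `c = r • ω^rel` (surjectivity, and `ω^rel` spans), so `r · ⟨ω^rel, α_* γ⟩ = 1`;
* `modelGeneratorK`, **`indexUnitK`** — for a real-linear identification `L : ℝⁿ ≅ F` (`n = 2k`) and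
  an orientation `g` of `ℝⁿ`, the INDEX UNIT `κ(L, g) := ⟨ω_k^rel,vec, L_* g_0⟩ ∈ ℤ`, with
  **`indexUnitK_eq_one_or_eq_neg_one : κ(L, g) = ±1`** and `κ(L, g)² = 1`.

Consequence (sequel `CompletionThomClassIndexDegree`): the local index of a non-degenerate zero of a
section of a rank-`k` complex bundle is `sign det · κ`, uniformly in the zero.
Everything is proved; no named facts.

## References

* J. Milnor, J. Stasheff, *Characteristic Classes*, Ann. of Math. Stud. 76, PUP 1974, §9 Thm. 9.1.
  [MilnorStasheff1974]
* D. Husemoller, *Fibre Bundles*, 3rd ed., GTM 20, Springer 1994, Ch. 17 §2 (2.3), Thm. 2.5.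
  [HusemollerFibreBundles1994]
* A. Hatcher, *Algebraic Topology*, CUP 2002, §3.1 Thm. 3.2, Thm. 3.12, §3.3 p. 231. [HatcherAT2002]
-/

noncomputable section

open CategoryTheory Limits Function Set Topology Module Literature.AlgebraicTopology.SingularHomology
  Literature.AlgebraicTopology.SingularHomology.LerayHirsch
open scoped LinearAlgebra.Projectivization

namespace Literature.AlgebraicTopology.CharacteristicClasses

/-! ### The Kronecker map of a pair is onto over a PID (Mathlib's model) -/

section Kronecker

variable {X : Type} [TopologicalSpace X]

/-- **Over a PID every functional on `Hₘ(X, A; R)` is `⟨c, ·⟩`** (Hatcher Thm. 3.2: `h` is onto), for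
the pairing against Mathlib's `relativeSingularHomology`. [cite: HatcherAT2002, §3.1 Thm. 3.2] -/
theorem relKroneckerM_surjective (R : Type) [CommRing R] [IsDomain R] [IsPrincipalIdealRing R] (A : Set X) (m : ℕ) :
    Surjective (relKroneckerM R X A m) := by
  intro ℓ
  set e := relativeSingularHomology.concreteIso R R X A m with he
  obtain ⟨c, hc⟩ := relKronecker_surjective (X := X) R A m (ℓ ∘ₗ e.inv.hom)
  refine ⟨c, LinearMap.ext fun x ↦ ?_⟩
  rw [relKroneckerM_apply, ← he, hc, LinearMap.comp_apply]
  change ℓ (e.inv (e.hom x)) = ℓ x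
  rw [Iso.hom_inv_id_apply]

/-- **If `ω` spans `Hᵐ(X, A; ℤ)` and `g ∈ Hₘ(X, A; ℤ)` is a generator of a copy of `ℤ`, then
`⟨ω, g⟩ = ±1`**: a functional with value `1` on `g` is `⟨r • ω, ·⟩`. [cite: HatcherAT2002, §3.1 Thm. 3.2] -/
theorem relKroneckerM_eq_one_or_eq_neg_one_of_span {A : Set X} {m : ℕ} {ω : relSingularCohomology ℤ ℤ X A m}
    (hω : ∀ c : relSingularCohomology ℤ ℤ X A m, ∃ r : ℤ, c = r • ω) {g : relativeSingularHomology ℤ ℤ X A m}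
    (hg : ∃ e : relativeSingularHomology ℤ ℤ X A m ≃ₗ[ℤ] ℤ, e g = 1) :
    relKroneckerM ℤ X A m ω g = 1 ∨ relKroneckerM ℤ X A m ω g = -1 := by
  obtain ⟨e, heg⟩ := hg
  obtain ⟨c, hc⟩ := relKroneckerM_surjective ℤ A m (e : relativeSingularHomology ℤ ℤ X A m →ₗ[ℤ] ℤ)
  obtain ⟨r, rfl⟩ := hω c
  have h1 : r * relKroneckerM ℤ X A m ω g = 1 := by
    have h := LinearMap.congr_fun hc g
    have h2 : relKroneckerM ℤ X A m (r • ω) g = r * relKroneckerM ℤ X A m ω g := by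
      change (relKroneckerM ℤ X A m).flip g (r • ω) = r * (relKroneckerM ℤ X A m).flip g ω
      rw [map_zsmul, zsmul_eq_mul, Int.cast_id]
    rw [← h2, h]
    exact heg
  rcases Int.eq_one_or_neg_one_of_mul_eq_one' h1 with ⟨_, h⟩ | ⟨_, h⟩
  · exact Or.inl h
  · exact Or.inr h

end Kronecker

/-! ### `H²ᵏ(ℙ(V); R) = R · xᵏ` for `dim V = k + 1` -/

section TopPower

variable (R : Type) [CommRing R] (V : Type) [NormedAddCommGroup V] [NormedSpace ℂ V] [FiniteDimensional ℂ V]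

/-- **The top cohomology of `ℙ(V)` is spanned by `xᵏ`** (`dim V = k + 1`; Husemoller (2.3) / Hatcher
Thm. 3.12: `H²ᵏ(ℂPᵏ) = R · xᵏ`): the Leray–Hirsch bijection of `ProjectiveSpaceLerayHirsch` over a
point, whose only non-vanishing source component in degree `2k` is `H⁰(pt) = R · 1`.
[cite: HusemollerFibreBundles1994, Ch. 17 §2 (2.3)] [cite: HatcherAT2002, Thm. 3.12] -/
theorem exists_eq_smul_xpow_top {k : ℕ} (hV : finrank ℂ V = k + 1) (y : singularCohomology R R (ℙ ℂ V) (2 * k)) :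
    ∃ r : R, y = r • xpow R V k := by
  -- on `pt × ℙ(V)`
  set y' := singularCohomology.map R R (ContinuousMap.snd : C(PUnit.{1} × ℙ ℂ V, ℙ ℂ V)) (2 * k) y with hy'
  obtain ⟨w, hw⟩ := ((projectiveSpace_lerayHirsch R k V hV) PUnit.{1} (2 * k)).2 y'
  have hres : restrictSrc R k (2 * k) w = 0 := src_punit_eq_zero R (N := k) (k := 2 * k) (fun j hj ↦ by omega) _
  have h2k : 2 * k ≤ 2 * k := le_rfl
  have e₀ : 2 * k - 2 * k = 0 := Nat.sub_self _
  have main : ∃ r : R, y' = r • singularCohomology.map R R (ContinuousMap.snd : C(PUnit.{1} × ℙ ℂ V, ℙ ℂ V)) (2 * k) (xpow R V k) := by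
    rw [← hw, lhMap_succ, hres, LinearMap.map_zero, zero_add, dif_pos h2k]
    obtain ⟨x₀, hx⟩ : ∃ x₀ : singularCohomology R R PUnit.{1} (2 * k - 2 * k), x₀ = w ⟨Fin.last k, h2k⟩ := ⟨_, rfl⟩
    rw [← hx]
    obtain ⟨r, hr⟩ := punit_zero_eq_smul_one R (degCast R e₀ x₀)
    refine ⟨r, ?_⟩
    change cupProduct (Nat.sub_add_cancel h2k)
      (singularCohomology.map R R (ContinuousMap.fst : C(PUnit.{1} × ℙ ℂ V, PUnit.{1})) (2 * k - 2 * k) x₀)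
      (singularCohomology.map R R (ContinuousMap.snd : C(PUnit.{1} × ℙ ℂ V, ℙ ℂ V)) (2 * k) (xpow R V k)) = _
    rw [← cupProduct_degCast_left R e₀ (show 0 + 2 * k = 2 * k by simp) (Nat.sub_add_cancel h2k),
      ← map_degCast, hr, map_smul, singularCohomology.map_one, smul_cupProduct, one_cupProduct]
  -- back to `ℙ(V)` along `ℓ ↦ (pt, ℓ)`
  obtain ⟨r, hr⟩ := main
  refine ⟨r, ?_⟩
  set ι : C(ℙ ℂ V, PUnit.{1} × ℙ ℂ V) := (ContinuousMap.const (ℙ ℂ V) PUnit.unit).prodMk (ContinuousMap.id _) with hι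
  have hιs : (ContinuousMap.snd : C(PUnit.{1} × ℙ ℂ V, ℙ ℂ V)).comp ι = ContinuousMap.id _ := rfl
  have h1 : y = singularCohomology.map R R ι (2 * k) y' := by
    rw [hy', ← ModuleCat.comp_apply, ← singularCohomology.map_comp, hιs, singularCohomology.map_id]
    rfl
  rw [h1, hr, map_smul, ← ModuleCat.comp_apply, ← singularCohomology.map_comp, hιs, singularCohomology.map_id]
  rfl

end TopPower

/-! ### `ω_k^rel` spans `H²ᵏ(ℙ(F ⊕ ℂ), ℙ ∖ [0 : 1]; ℤ)` -/

section Model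

variable (F : Type) [NormedAddCommGroup F] [NormedSpace ℂ F] [FiniteDimensional ℂ F]
  {k : ℕ} (hF : finrank ℂ F = k) (hk : 1 ≤ k)

include hF in
/-- `dim (F ⊕ ℂ) = k + 1`. [folklore] -/
theorem finrank_model_prod_succ : finrank ℂ (F × ℂ) = k + 1 := by
  rw [Module.finrank_prod, hF, Module.finrank_self]

/-- **Every class of `H²ᵏ(ℙ(F ⊕ ℂ), ℙ ∖ [0 : 1]; ℤ)` is a multiple of `ω_k^rel`**: its image in
`H²ᵏ(ℙ; ℤ) = ℤ · xᵏ` is `r • xᵏ = (r • ω_k^rel)|`, and relative lifts are unique.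
[cite: HusemollerFibreBundles1994, Ch. 17 §2 (2.3)] [cite: HatcherAT2002, §3.1 p. 200] -/
theorem exists_eq_smul_omegaRelK (c : relSingularCohomology ℤ ℤ (ℙ ℂ (F × ℂ)) (modelVectorPart F) (2 * k)) :
    ∃ r : ℤ, c = r • omegaRelK F hF hk := by
  obtain ⟨r, hr⟩ := exists_eq_smul_xpow_top ℤ (F × ℂ) (finrank_model_prod_succ F hF)
    (relSingularCohomology.toAbsolute ℤ ℤ (ℙ ℂ (F × ℂ)) (modelVectorPart F) (2 * k) c)
  refine ⟨r, toAbsolute_modelVectorPart_injective_int F hF hk ?_⟩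
  rw [hr, map_zsmul, toAbsolute_omegaRelK]
  exact int_smul_eq_zsmul _ r _

/-! ### `⟨ω_k^rel,vec, γ⟩ = ±1` -/

include hk in
/-- **The model class pairs to `±1` with every local orientation generator of the fibre**: for every
generator `γ` of `H₂ₖ(F, F ∖ 0; ℤ) ≅ ℤ`,

  `⟨ω_k^rel,vec, γ⟩ = ±1`.

Proof: `⟨α^* ω^rel, γ⟩ = ⟨ω^rel, α_* γ⟩`, `α_* γ` generates `H₂ₖ(ℙ | [0 : 1]; ℤ)` (excision), `ω^rel`
spans `H²ᵏ(ℙ, ℙ₀; ℤ)`, and the Kronecker map is onto (`relKroneckerM_eq_one_or_eq_neg_one_of_span`).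
This is the homological content of Milnor–Stasheff's normalisation "`u|(F, F₀)` is the preferred
generator" for the tree's Chern-class normalisation of the Thom class, every rank.
[cite: MilnorStasheff1974, §9 Thm. 9.1] [cite: HatcherAT2002, §3.1 Thm. 3.2] -/
theorem relKroneckerM_omegaRelVecK_eq_one_or_eq_neg_one {γ : localHomology ℤ ℤ F (0 : F) (2 * k)}
    (hγ : ∃ e : localHomology ℤ ℤ F (0 : F) (2 * k) ≃ₗ[ℤ] ℤ, e γ = 1) :
    relKroneckerM ℤ F ({0}ᶜ : Set F) (2 * k) (omegaRelVecK F hF hk) γ = 1 ∨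
      relKroneckerM ℤ F ({0}ᶜ : Set F) (2 * k) (omegaRelVecK F hF hk) γ = -1 := by
  rw [omegaRelVecK, relKroneckerM_map]
  refine relKroneckerM_eq_one_or_eq_neg_one_of_span (exists_eq_smul_omegaRelK F hF hk) ?_
  haveI : T2Space (ℙ ℂ (F × ℂ)) := t2Space_of_finiteDimensional ℂ (F × ℂ)
  -- `α_*` is an isomorphism (excision along the open embedding `u ↦ [u : 1]`; cf. `isIso_map_vecEmbed`)
  haveI := localHomology.isIso_map_of_isOpenEmbedding_of_eq ℤ ℤ (vecEmbed F) (isOpenEmbedding_vecEmbed F) 0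
    (vecEmbed_zero F) (2 * k)
  exact exists_linearEquiv_apply_eq_one_of_linearEquiv
    (asIso (relativeSingularHomology.map ℤ ℤ (vecEmbed F) (mapsTo_vecEmbed F) (2 * k))).toLinearEquiv hγ

/-! ### The index unit of a real frame of the fibre -/

variable {n : ℕ} (hn : 2 * k = n) (L : (EuclideanSpace ℝ (Fin n)) ≃L[ℝ] F)

omit [FiniteDimensional ℂ F] in
/-- `L` is a map of pairs `(ℝⁿ, ℝⁿ ∖ 0) → (F, F ∖ 0)`. [folklore] -/
theorem mapsTo_frame : MapsTo (L.toHomeomorph : C(EuclideanSpace ℝ (Fin n), F)) ({0}ᶜ : Set (EuclideanSpace ℝ (Fin n))) ({0}ᶜ : Set F) := by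
  intro v hv h0
  exact hv ((L.map_eq_zero_iff).1 h0)

omit [FiniteDimensional ℂ F] in
/-- `L⁻¹` is a map of pairs `(F, F ∖ 0) → (ℝⁿ, ℝⁿ ∖ 0)`. [folklore] -/
theorem mapsTo_frame_symm : MapsTo (L.toHomeomorph.symm : C(F, EuclideanSpace ℝ (Fin n))) ({0}ᶜ : Set F) ({0}ᶜ : Set (EuclideanSpace ℝ (Fin n))) := by
  intro u hu h0
  exact hu ((L.symm.map_eq_zero_iff).1 h0)

omit [FiniteDimensional ℂ F] in
/-- **The transported local orientation generator** `L_* g_0 ∈ Hₙ(F, F ∖ 0; ℤ)` of an orientation `g`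
of `ℝⁿ` along the real frame `L : ℝⁿ ≅ F` (cross-universe-safe transport `xEquiv`). [folklore] -/
def modelGeneratorK (g : HomologicalOrientation ℤ (EuclideanSpace ℝ (Fin n)) n) : relativeSingularHomology ℤ ℤ F ({0}ᶜ : Set F) n :=
  relativeSingularHomology.xEquiv ℤ ℤ L.toHomeomorph (mapsTo_frame F L) (mapsTo_frame_symm F L) n (g.localClass 0)

omit [FiniteDimensional ℂ F] in
/-- `L_* g_0` generates `Hₙ(F, F ∖ 0; ℤ)`. [folklore] -/
theorem isGenerator_modelGeneratorK (g : HomologicalOrientation ℤ (EuclideanSpace ℝ (Fin n)) n) :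
    ∃ e : relativeSingularHomology ℤ ℤ F ({0}ᶜ : Set F) n ≃ₗ[ℤ] ℤ, e (modelGeneratorK F L g) = 1 :=
  exists_linearEquiv_apply_eq_one_of_linearEquiv _ (g.isGenerator 0)

/-- **The index unit `κ(L, g) := ⟨ω_k^rel,vec, L_* g_0⟩ ∈ ℤ`** of a real frame `L : ℝⁿ ≅ F` (`n = 2k`)
and an orientation `g` of `ℝⁿ`: the value of the tree's model relative Thom class on the transported
orientation generator. [cite: MilnorStasheff1974, §9 Thm. 9.1] -/
def indexUnitK (g : HomologicalOrientation ℤ (EuclideanSpace ℝ (Fin n)) n) : ℤ :=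
  relKroneckerM ℤ F ({0}ᶜ : Set F) n (ComplexVectorBundle.relDegCast ℤ hn (omegaRelVecK F hF hk)) (modelGeneratorK F L g)

/-- **`κ(L, g) = ±1`.** [cite: MilnorStasheff1974, §9 Thm. 9.1] -/
theorem indexUnitK_eq_one_or_eq_neg_one (g : HomologicalOrientation ℤ (EuclideanSpace ℝ (Fin n)) n) :
    indexUnitK F hF hk hn L g = 1 ∨ indexUnitK F hF hk hn L g = -1 := by
  subst hn
  rw [indexUnitK, ComplexVectorBundle.relDegCast_rfl]
  exact relKroneckerM_omegaRelVecK_eq_one_or_eq_neg_one F hF hk (isGenerator_modelGeneratorK F L g)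

/-- `κ(L, g)² = 1`. [folklore] -/
theorem indexUnitK_mul_self (g : HomologicalOrientation ℤ (EuclideanSpace ℝ (Fin n)) n) :
    indexUnitK F hF hk hn L g * indexUnitK F hF hk hn L g = 1 := by
  rcases indexUnitK_eq_one_or_eq_neg_one F hF hk hn L g with h | h <;> rw [h] <;> norm_num

/-- The index unit only sees the local class at the origin: opposite classes give opposite units. [folklore] -/
theorem indexUnitK_eq_neg_of_localClass_eq_neg {g g' : HomologicalOrientation ℤ (EuclideanSpace ℝ (Fin n)) n}
    (h : g.localClass 0 = -g'.localClass 0) : indexUnitK F hF hk hn L g = -indexUnitK F hF hk hn L g' := by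
  simp only [indexUnitK, modelGeneratorK, h, map_neg]

/-- The index unit only sees the local class at the origin. [folklore] -/
theorem indexUnitK_eq_of_localClass_eq {g g' : HomologicalOrientation ℤ (EuclideanSpace ℝ (Fin n)) n}
    (h : g.localClass 0 = g'.localClass 0) : indexUnitK F hF hk hn L g = indexUnitK F hF hk hn L g' := by
  simp only [indexUnitK, modelGeneratorK, h]

end Model

end Literature.AlgebraicTopology.CharacteristicClasses

end
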